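import Mathlib.LinearAlgebra.Basis.Basic
import Mathlib.LinearAlgebra.LinearIndependent.Lemmas
import Mathlib.LinearAlgebra.FiniteDimensional.Lemmas
import Mathlib.Data.Complex.Basic
import Mathlib.Tactic.FieldSimp
import Mathlib.Tactic.LinearCombination
import HarnessLib

/-!
# Rigidity of rational structures under monomial symmetries

An elementary uniqueness statement for **rational structures** inside a finite-dimensional complex
vector space, isolated from the comparison "de Rham classes of the lattice forms `dx_I` versus
rational singular classes" on a complex torus (Lange–Birkenhake (1992), §1.1.3 Lemma 1.1.17 and
§1.1.4 Prop. 1.1.20: the `dx_I` are an INTEGRAL basis; what is recorded here is the purely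
linear-algebraic mechanism by which a rational structure stable under the coordinate projections
and the signed permutations of a basis is pinned down up to ONE scalar).

Setting: `V` a `ℂ`-vector space with a basis `b : Fin n → V` (the lattice monomials) and a subset
`S ⊆ V` (the rational classes) which is a `ℚ`-subspace in the elementary sense (`IsRatSubspace`:
`0 ∈ S`, closed under `+` and under the rational scalars `(q : ℂ) •`; the ambient space carries no
`Module ℚ` instance in the applications) and **rational** (`IsRational`: `ℚ`-linearly independent
finite families in `S` are `ℂ`-linearly independent — for singular cohomology the tree's
`HodgeTheory.linearIndependent_of_isRationalClass`). Hypotheses of the main result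
`exists_ratBasis_smul_basis`: the coordinate projections `s ↦ b*_w(s) b_w` preserve `S`; `S`
contains a `ℚ`-independent family of full size `n`; and for all `w, w'` some `ℂ`-linear map
preserving `S` sends `b_w` to `± b_{w'}`. Conclusion: **there is one scalar `c ≠ 0` such that `S` is
exactly the set of rational combinations of the `c • b_w`, with unique coefficients** (the shape of
`IsRatBasisOn S (c • b)` of `Literature/Barriers/HodgeConjecture/GeneralizedHodgeTrivialReasons`).

`Mathlib`-only; no topology.

## References

* H. Lange, Ch. Birkenhake, *Complex Abelian Varieties* (1992), §1.1.3 Lemma 1.1.17, §1.1.4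
  Prop. 1.1.20. [LangeBirkenhake1992]
-/

noncomputable section

open Function Module

namespace Literature.LinearAlgebra.RationalForms

variable {V : Type*} [AddCommGroup V] [Module ℂ V]

/-! ### Elementary rational subspaces of a complex vector space -/

/-- A subset `S ⊆ V` is a **`ℚ`-subspace**: `0 ∈ S`, closed under addition and under the rational
scalars `(q : ℂ) •`. [folklore] -/
structure IsRatSubspace (S : Set V) : Prop where
  /-- `0 ∈ S`. [folklore] -/
  zero_mem : (0 : V) ∈ S
  /-- `S` is closed under addition. [folklore] -/
  add_mem : ∀ ⦃s t : V⦄, s ∈ S → t ∈ S → s + t ∈ S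
  /-- `S` is closed under rational scalars. [folklore] -/
  smul_mem : ∀ (q : ℚ) ⦃s : V⦄, s ∈ S → ((q : ℂ) • s) ∈ S

namespace IsRatSubspace

variable {S : Set V} (hS : IsRatSubspace S)
include hS

/-- `S` is closed under negation. [folklore] -/
theorem neg_mem ⦃s : V⦄ (hs : s ∈ S) : -s ∈ S := by
  simpa using hS.smul_mem (-1) hs

/-- `S` is closed under rational combinations. [folklore] -/
theorem sum_smul_mem {ι : Type*} (t : Finset ι) (q : ι → ℚ) {f : ι → V} (hf : ∀ i ∈ t, f i ∈ S) :
    (∑ i ∈ t, ((q i : ℚ) : ℂ) • f i) ∈ S := by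
  classical
  induction t using Finset.induction_on with
  | empty => simpa using hS.zero_mem
  | insert a t ha ih =>
    rw [Finset.sum_insert ha]
    exact hS.add_mem (hS.smul_mem _ (hf a (Finset.mem_insert_self a t)))
      (ih fun i hi ↦ hf i (Finset.mem_insert_of_mem hi))

end IsRatSubspace

/-- **Rationality**: `ℚ`-linearly independent finite families in `S` are `ℂ`-linearly independent
("`S ⊗_ℚ ℂ → V` is injective"). [folklore] -/
def IsRational (S : Set V) : Prop :=
  ∀ (m : ℕ) (f : Fin m → V), (∀ i, f i ∈ S) →
    (∀ q : Fin m → ℚ, ∑ i, ((q i : ℚ) : ℂ) • f i = 0 → q = 0) → LinearIndependent ℂ f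

/-- The **stalk** of `S` along a vector `x`: the scalars `c` with `c • x ∈ S`. [folklore] -/
def stalk (S : Set V) (x : V) : Set ℂ := {c | c • x ∈ S}

/-- Membership in the stalk. [folklore] -/
@[simp] theorem mem_stalk_iff {S : Set V} {x : V} {c : ℂ} : c ∈ stalk S x ↔ c • x ∈ S := Iff.rfl

/-- Rational multiples stay in the stalk. [folklore] -/
theorem ratCast_mul_mem_stalk {S : Set V} (hS : IsRatSubspace S) {x : V} {c : ℂ} (hc : c ∈ stalk S x)
    (q : ℚ) : (q : ℂ) * c ∈ stalk S x := by
  rw [mem_stalk_iff, mul_smul]; exact hS.smul_mem q hc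

/-- **Two scalars of the stalk of a non-zero vector are `ℚ`-proportional** in a rational
`ℚ`-subspace: if `c • x, c' • x ∈ S` and `c ≠ 0` then `c' = q c` for a rational `q` (otherwise
`c • x`, `c' • x` would be `ℚ`-independent members of `S`, hence `ℂ`-independent). [folklore] -/
theorem exists_rat_of_mem_stalk {S : Set V} (hR : IsRational S) {x : V} (hx : x ≠ 0) {c c' : ℂ}
    (hc : c ∈ stalk S x) (hc' : c' ∈ stalk S x) (hc0 : c ≠ 0) : ∃ q : ℚ, c' = (q : ℂ) * c := by
  by_contra hq
  push Not at hq
  have hind : ∀ q : Fin 2 → ℚ, ∑ i, ((q i : ℚ) : ℂ) • ![c • x, c' • x] i = 0 → q = 0 := by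
    intro q h
    rw [Fin.sum_univ_two] at h
    simp only [Matrix.cons_val_zero, Matrix.cons_val_one, smul_smul, ← add_smul] at h
    have h0 : (q 0 : ℂ) * c + (q 1 : ℂ) * c' = 0 := by
      rcases smul_eq_zero.1 h with h | h
      · exact h
      · exact absurd h hx
    by_cases h1 : q 1 = 0
    · have h00 : (q 0 : ℂ) * c = 0 := by simpa [h1] using h0
      have hq0 : q 0 = 0 := by exact_mod_cast (mul_eq_zero.1 h00).resolve_right hc0
      funext i; fin_cases i
      · exact hq0
      · exact h1
    · exfalso
      refine hq (-(q 0 / q 1)) ?_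
      have h1' : (q 1 : ℂ) ≠ 0 := by exact_mod_cast h1
      push_cast
      field_simp
      linear_combination h0
  have hli := hR 2 ![c • x, c' • x] (fun i ↦ by
    fin_cases i
    · exact hc
    · exact hc') hind
  have hdep : c' • (![c • x, c' • x] 0) + (-c) • (![c • x, c' • x] 1) = 0 := by
    simp [smul_smul, mul_comm]
  have h2 := LinearIndependent.pair_iff.1 hli c' (-c) hdep
  exact hc0 (neg_eq_zero.1 h2.2)

/-! ### Rigidity -/

section Rigidity

variable {n : ℕ} (b : Basis (Fin n) ℂ V) {S : Set V}

/-- **Each stalk along a basis vector is a rational line `ℚ c_w` with `c_w ≠ 0`,** provided the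
coordinate projections preserve the rational `ℚ`-subspace `S` and `S` contains a `ℚ`-independent
family of full size. [folklore] -/
theorem exists_stalk_basis_eq (hS : IsRatSubspace S) (hR : IsRational S)
    (hproj : ∀ w, ∀ s ∈ S, b.coord w s • b w ∈ S)
    (hfull : ∃ f : Fin n → V, (∀ i, f i ∈ S) ∧
      ∀ q : Fin n → ℚ, ∑ i, ((q i : ℚ) : ℂ) • f i = 0 → q = 0) (w : Fin n) :
    ∃ c : ℂ, c ≠ 0 ∧ stalk S (b w) = Set.range fun q : ℚ ↦ (q : ℂ) * c := by
  classical
  obtain ⟨f, hfS, hfind⟩ := hfull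
  have hfli : LinearIndependent ℂ f := hR n f hfS hfind
  haveI : FiniteDimensional ℂ V := Module.Finite.of_basis b
  haveI : Nonempty (Fin n) := ⟨w⟩
  -- some `f i` has a non-zero `w`-coordinate (the `f i` span, `b w` has `w`-coordinate `1`)
  have hspan : ⊤ ≤ Submodule.span ℂ (Set.range f) :=
    (hfli.span_eq_top_of_card_eq_finrank (by rw [finrank_eq_card_basis b])).ge
  obtain ⟨i, hi⟩ : ∃ i, b.coord w (f i) ≠ 0 := by
    by_contra h
    push Not at h
    have hker : Submodule.span ℂ (Set.range f) ≤ LinearMap.ker (b.coord w) := by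
      rw [Submodule.span_le]; rintro _ ⟨i, rfl⟩; exact h i
    have h1 : b.coord w (b w) = 0 := hker (hspan Submodule.mem_top)
    rw [Basis.coord_apply, Basis.repr_self, Finsupp.single_eq_same] at h1
    exact one_ne_zero h1
  set c := b.coord w (f i)
  have hc : c ∈ stalk S (b w) := hproj w _ (hfS i)
  refine ⟨c, hi, Set.ext fun c' ↦ ⟨fun hc' ↦ ?_, ?_⟩⟩
  · obtain ⟨q, rfl⟩ := exists_rat_of_mem_stalk hR (b.ne_zero w) hc hc' hi
    exact ⟨q, rfl⟩
  · rintro ⟨q, rfl⟩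
    exact ratCast_mul_mem_stalk hS hc q

/-- **Transport of stalks**: an `S`-preserving linear map sending `x` to `± y` carries the stalk of
`x` into the stalk of `y`. [folklore] -/
theorem stalk_subset_of_map (hS : IsRatSubspace S) {x y : V} (P : V →ₗ[ℂ] V)
    (hP : ∀ s ∈ S, P s ∈ S) {ε : ℂ} (hε : ε = 1 ∨ ε = -1) (hPx : P x = ε • y) :
    stalk S x ⊆ stalk S y := by
  intro c hc
  have h : c • P x ∈ S := by rw [← map_smul]; exact hP _ hc
  rw [hPx, smul_comm] at h
  rcases hε with rfl | rfl
  · simpa using h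
  · simpa using hS.neg_mem h

/-- **Rigidity of rational structures under monomial symmetries.** Let `b` be a basis of `V` and
`S ⊆ V` a rational `ℚ`-subspace stable under the coordinate projections of `b`, containing a
`ℚ`-independent family of full size, and such that for all `w, w'` some `S`-preserving linear map
sends `b_w` to `± b_{w'}`. Then for ONE scalar `c ≠ 0` the vectors `c • b_w` lie in `S` and every
element of `S` is a rational combination of them with unique coefficients. [folklore] -/
theorem exists_ratBasis_smul_basis (hS : IsRatSubspace S) (hR : IsRational S)
    (hproj : ∀ w, ∀ s ∈ S, b.coord w s • b w ∈ S)
    (hfull : ∃ f : Fin n → V, (∀ i, f i ∈ S) ∧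
      ∀ q : Fin n → ℚ, ∑ i, ((q i : ℚ) : ℂ) • f i = 0 → q = 0)
    (hperm : ∀ w w' : Fin n, ∃ P : V →ₗ[ℂ] V, (∀ s ∈ S, P s ∈ S) ∧
      ∃ ε : ℂ, (ε = 1 ∨ ε = -1) ∧ P (b w) = ε • b w') :
    ∃ c : ℂ, c ≠ 0 ∧ (∀ w, c • b w ∈ S) ∧
      ∀ s ∈ S, ∃! q : Fin n → ℚ, ∑ w, ((q w : ℚ) : ℂ) • (c • b w) = s := by
  classical
  rcases Nat.eq_zero_or_pos n with rfl | hn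
  · -- no basis vectors: `V = 0`, `S = {0}`
    refine ⟨1, one_ne_zero, fun w ↦ w.elim0, fun s hs ↦ ⟨Fin.elim0, ?_, fun q _ ↦ funext fun w ↦ w.elim0⟩⟩
    have hs0 : s = 0 := by simpa using (b.sum_repr s).symm
    simp [hs0]
  · obtain ⟨w₀⟩ : Nonempty (Fin n) := ⟨⟨0, hn⟩⟩
    -- all stalks along basis vectors coincide
    have hst : ∀ w w', stalk S (b w) ⊆ stalk S (b w') := fun w w' ↦ by
      obtain ⟨P, hP, ε, hε, hPw⟩ := hperm w w'
      exact stalk_subset_of_map hS P hP hε hPw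
    obtain ⟨c, hc0, hcw₀⟩ := exists_stalk_basis_eq b hS hR hproj hfull w₀
    have hsw : ∀ w, stalk S (b w) = Set.range fun q : ℚ ↦ (q : ℂ) * c := fun w ↦ by
      rw [← hcw₀]; exact Set.Subset.antisymm (hst w w₀) (hst w₀ w)
    have hcmem : ∀ w, c • b w ∈ S := fun w ↦ by
      have : c ∈ stalk S (b w) := by rw [hsw]; exact ⟨1, by simp⟩
      exact this
    refine ⟨c, hc0, hcmem, fun s hs ↦ ?_⟩
    -- coordinates of `s` are rational multiples of `c`
    have hq : ∀ w, ∃ q : ℚ, b.coord w s = (q : ℂ) * c := fun w ↦ by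
      have h : b.coord w s ∈ stalk S (b w) := hproj w s hs
      rw [hsw] at h
      obtain ⟨q, hq⟩ := h
      exact ⟨q, hq.symm⟩
    choose q hq using hq
    refine ⟨q, ?_, fun q' hq' ↦ ?_⟩
    · calc ∑ w, ((q w : ℚ) : ℂ) • (c • b w) = ∑ w, b.coord w s • b w := by
            refine Finset.sum_congr rfl fun w _ ↦ ?_
            rw [smul_smul, hq w]
        _ = s := by
            conv_rhs => rw [← b.sum_repr s]
            rfl
    · funext w
      have h := congrArg (fun v ↦ b.coord w v) hq'
      simp only [map_sum, map_smul, Basis.coord_apply, Basis.repr_self, smul_eq_mul,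
        Finsupp.single_apply, mul_ite, mul_one, mul_zero, Finset.sum_ite_eq', Finset.mem_univ,
        ↓reduceIte] at h
      rw [← Basis.coord_apply, hq w] at h
      have h' : ((q' w : ℚ) : ℂ) = q w := mul_right_cancel₀ hc0 h
      exact_mod_cast h'

end Rigidity

end Literature.LinearAlgebra.RationalForms

end
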